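import Mathlib.Analysis.SpecialFunctions.Integrals.Basic
import Mathlib.Analysis.SpecialFunctions.Trigonometric.Series
import Literature.Analysis.FunctionSpaces.BesselJProofs
import HarnessLib

/-!
# Poisson's integrals for `J₀` and `J₁`

`Literature.Analysis.FunctionSpaces.BesselJ` defines the Bessel functions `Literature.besselJ n` of order
`n : ℕ` by their power series (Watson §2.1 (8); DLMF 10.2.2). This file proves, directly from the
series, the two integral representations

* `Literature.Analysis.FunctionSpaces.integral_cos_mul_cos_eq_pi_mul_besselJ_zero`:
  `∫₀^π cos(y cos θ) dθ = π J₀(y)` (Poisson's integral for integer order, Andrews–Askey–Roy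
  (4.9.12) with `n = 0`; DLMF 10.9.1; Lieb–Wu, Physica A 321 (2003) 1, §6:
  `J₀(ω) = (2/π) ∫₀^{π/2} cos(ω cos θ) dθ`);
* `Literature.Analysis.FunctionSpaces.mul_integral_cos_mul_cos_mul_sin_sq_eq_pi_mul_besselJ_one`:
  `y ∫₀^π cos(y cos θ) sin²θ dθ = π J₁(y)` (Andrews–Askey–Roy (4.9.12) with `n = 1`,
  `(1/2)₁ = 1/2`: `J₁(x) = (x/2)/(π/2) ∫₀^π cos(x cos θ) sin²θ dθ`; DLMF 10.9.4 with `ν = 1`;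
  Lieb–Wu, Physica A 321 (2003) 1, §6: `J₁(ω) = ω π⁻¹ ∫₀^π cos(ω sin p) cos²p dp`, the same
  integral after `p ↦ π/2 - p`),

by expanding `cos(y cos θ)` in its power series, integrating term by term (dominated convergence,
the series being dominated by that of `cosh y`), and evaluating the Wallis integrals
`∫₀^π cos^{2k}θ dθ = π (2k)!/(4^k (k!)²)` (`Literature.Analysis.FunctionSpaces.integral_cos_pow_even_eq`) — the proof Andrews–Askey–Roy
give for (4.7.5): "expand the exponential function in the integrand as a series and integrate ...
beta integrals".

These representations identify the Fourier transforms of the arcsine and semicircle densities on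
`[-1, 1]` with `J₀` and `J₁(y)/y`; they are the input for the Weber–Schafheitlin integral
`∫₀^∞ J₀ J₁ / ω dω = 2/π` behind the free-fermion limit of the Lieb–Wu energy
(`Literature.Analysis.FunctionSpaces.LiebWuIntegrals`).

## References

* G. E. Andrews, R. Askey, R. Roy, *Special Functions* (Cambridge, 1999), §4.7, eqs. (4.7.5)–(4.7.6)
  (Poisson's integral `J_α(x) = (x/2)^α/(√π Γ(α+1/2)) ∫₀^π cos(x cos θ) sin^{2α}θ dθ`, `Re α > -1/2`),
  §4.9, eq. (4.9.12) (`J_n(x) = (x/2)^n/(π (1/2)_n) ∫₀^π cos(x cos θ) sin^{2n}θ dθ`, `n ∈ ℕ`).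
* NIST DLMF 10.9.1 (`J₀(z) = π⁻¹ ∫₀^π cos(z cos θ) dθ`), 10.9.4 (Poisson's integral).
* E. H. Lieb, F. Y. Wu, *The one-dimensional Hubbard model: a reminiscence*, Physica A 321 (2003)
  1–27 (arXiv:cond-mat/0207529), §6 (integral representations of `J₀`, `J₁` quoted there).
-/

noncomputable section

open scoped Topology
open Filter Set MeasureTheory intervalIntegral Real Nat

namespace Literature.Analysis.FunctionSpaces

/-! ## Wallis integrals of even powers of the cosine over `[0, π]` -/

/-- `∫₀^π cos^{2k} θ dθ = π (2k)! / (4^k (k!)²)` (Wallis's formula for even cosine powers over a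
half period). [folklore] -/
theorem integral_cos_pow_even_eq (k : ℕ) :
    ∫ θ in (0 : ℝ)..π, cos θ ^ (2 * k) = π * ((2 * k)! : ℝ) / ((4 : ℝ) ^ k * ((k ! : ℝ)) ^ 2) := by
  induction k with
  | zero => simp
  | succ k ih =>
    have h2 : 2 * (k + 1) = 2 * k + 2 := by ring
    have hf : ((2 * k + 2)! : ℝ) = (2 * k + 2) * (2 * k + 1) * (2 * k)! := by
      rw [Nat.factorial_succ, Nat.factorial_succ]; push_cast; ring
    have hf' : ((k + 1)! : ℝ) = (k + 1) * k ! := by rw [Nat.factorial_succ]; push_cast; ring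
    rw [h2, integral_cos_pow, sin_zero, sin_pi, mul_zero, mul_zero, sub_zero, zero_div, zero_add, ih,
      hf, hf']
    have hk : ((k ! : ℝ)) ≠ 0 := by positivity
    have h2k : ((2 * k : ℕ) : ℝ) + 2 ≠ 0 := by positivity
    push_cast
    field_simp
    ring

/-- `∫₀^π cos^{2k} θ sin² θ dθ = π (2k)! / (4^k (k!)² (2k + 2))`. [folklore] -/
theorem integral_cos_pow_even_mul_sin_sq_eq (k : ℕ) :
    ∫ θ in (0 : ℝ)..π, cos θ ^ (2 * k) * sin θ ^ 2 =
      π * ((2 * k)! : ℝ) / ((4 : ℝ) ^ k * ((k ! : ℝ)) ^ 2 * (2 * k + 2)) := by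
  have h1 : ∀ θ : ℝ, cos θ ^ (2 * k) * sin θ ^ 2 = cos θ ^ (2 * k) - cos θ ^ (2 * k + 2) := by
    intro θ; rw [sin_sq, pow_add]; ring
  have hrec : ∫ θ in (0 : ℝ)..π, cos θ ^ (2 * k + 2) =
      (2 * k + 1) / (2 * k + 2) * ∫ θ in (0 : ℝ)..π, cos θ ^ (2 * k) := by
    rw [integral_cos_pow, sin_zero, sin_pi, mul_zero, mul_zero, sub_zero, zero_div, zero_add]
    push_cast; ring
  have hc1 : Continuous fun θ : ℝ => cos θ ^ (2 * k) := by fun_prop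
  have hc2 : Continuous fun θ : ℝ => cos θ ^ (2 * k + 2) := by fun_prop
  simp_rw [h1]
  rw [integral_sub (hc1.intervalIntegrable _ _) (hc2.intervalIntegrable _ _), hrec,
    integral_cos_pow_even_eq]
  have hk : ((k ! : ℝ)) ≠ 0 := by positivity
  have h2k : (2 * (k : ℝ)) + 2 ≠ 0 := by positivity
  field_simp
  ring

/-! ## Term-wise integration of the cosine series -/

/-- Term-wise integration: for a continuous weight `w` with `|w| ≤ 1`,
`∫₀^π cos(y cos θ) w(θ) dθ = ∑_k (-1)^k y^{2k}/(2k)! ∫₀^π cos^{2k}θ w(θ) dθ`, by dominated convergence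
(the `k`-th term is bounded by `|y|^{2k}/(2k)!`, a summable sequence with sum `cosh y`). [folklore] -/
theorem hasSum_integral_cos_mul_cos (y : ℝ) {w : ℝ → ℝ} (hw : Continuous w)
    (hw1 : ∀ θ, |w θ| ≤ 1) :
    HasSum (fun k : ℕ => (-1) ^ k * y ^ (2 * k) / (2 * k)! *
        ∫ θ in (0 : ℝ)..π, cos θ ^ (2 * k) * w θ)
      (∫ θ in (0 : ℝ)..π, cos (y * cos θ) * w θ) := by
  have key := intervalIntegral.hasSum_integral_of_dominated_convergence
    (μ := volume) (a := 0) (b := π)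
    (F := fun (k : ℕ) (θ : ℝ) => (-1) ^ k * (y * cos θ) ^ (2 * k) / (2 * k)! * w θ)
    (f := fun θ => cos (y * cos θ) * w θ)
    (fun k _ => |y| ^ (2 * k) / (2 * k)!) (fun k => ?_) (fun k => ?_) ?_ ?_ ?_
  · have hF : (fun k : ℕ => ∫ θ in (0 : ℝ)..π,
        (-1) ^ k * (y * cos θ) ^ (2 * k) / (2 * k)! * w θ) =
        fun k : ℕ => (-1) ^ k * y ^ (2 * k) / (2 * k)! *
          ∫ θ in (0 : ℝ)..π, cos θ ^ (2 * k) * w θ := by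
      funext k
      rw [← intervalIntegral.integral_const_mul]
      congr 1
      funext θ
      rw [mul_pow]
      ring
    rw [hF] at key
    exact key
  · exact Continuous.aestronglyMeasurable (by fun_prop)
  · refine ae_of_all _ fun θ _ => ?_
    rw [Real.norm_eq_abs, abs_mul, abs_div, abs_mul, abs_pow, abs_pow, abs_neg, abs_one, one_pow,
      one_mul, Nat.abs_cast, abs_mul, mul_pow]
    have hc : |cos θ| ^ (2 * k) ≤ 1 := pow_le_one₀ (abs_nonneg _) (abs_cos_le_one θ)
    have hk : (0 : ℝ) < (2 * k)! := by positivity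
    calc |y| ^ (2 * k) * |cos θ| ^ (2 * k) / (2 * k)! * |w θ|
        ≤ |y| ^ (2 * k) * 1 / (2 * k)! * 1 := by
          gcongr
          exact hw1 θ
      _ = |y| ^ (2 * k) / (2 * k)! := by ring
  · exact ae_of_all _ fun θ _ => (Real.hasSum_cosh |y|).summable
  · exact intervalIntegrable_const
  · exact ae_of_all _ fun θ _ => (Real.hasSum_cos (y * cos θ)).mul_right (w θ)

/-! ## The two Poisson integrals -/

/-- The `k`-th term of `π J₀(y)` is the `k`-th term of the integrated cosine series. [folklore] -/
theorem pi_mul_besselJTerm_zero (y : ℝ) (k : ℕ) :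
    (-1) ^ k * y ^ (2 * k) / (2 * k)! * (π * ((2 * k)! : ℝ) / ((4 : ℝ) ^ k * ((k ! : ℝ)) ^ 2)) =
      π * besselJTerm 0 y k := by
  rw [besselJTerm, div_pow]
  have hk : ((k ! : ℝ)) ≠ 0 := by positivity
  have hk2 : ((2 * k)! : ℝ) ≠ 0 := by positivity
  have h4 : (4 : ℝ) ^ k = 2 ^ (2 * k) := by rw [pow_mul]; norm_num
  simp only [add_zero, h4]
  field_simp

/-- The `k`-th term of `π J₁(y)` is `y` times the `k`-th term of the integrated cosine series with
weight `sin²`. [folklore] -/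
theorem pi_mul_besselJTerm_one (y : ℝ) (k : ℕ) :
    y * ((-1) ^ k * y ^ (2 * k) / (2 * k)! *
      (π * ((2 * k)! : ℝ) / ((4 : ℝ) ^ k * ((k ! : ℝ)) ^ 2 * (2 * k + 2)))) =
      π * besselJTerm 1 y k := by
  rw [besselJTerm, div_pow]
  have hk : ((k ! : ℝ)) ≠ 0 := by positivity
  have hk2 : ((2 * k)! : ℝ) ≠ 0 := by positivity
  have h4 : (4 : ℝ) ^ k = 2 ^ (2 * k) := by rw [pow_mul]; norm_num
  have hf' : ((k + 1)! : ℝ) = (k + 1) * k ! := by rw [Nat.factorial_succ]; push_cast; ring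
  have h2k : (2 * (k : ℝ)) + 2 ≠ 0 := by positivity
  simp only [h4, hf', pow_succ]
  field_simp

/-- **Poisson's integral for `J₀`**: `∫₀^π cos(y cos θ) dθ = π J₀(y)` for every real `y`
(Andrews–Askey–Roy (4.9.12) with `n = 0`; DLMF 10.9.1). Proof: term-wise integration of the cosine
series and the Wallis integrals `∫₀^π cos^{2k} = π(2k)!/(4^k k!²)`. [cite: AndrewsAskeyRoy1999, §4.9 (4.9.12)] -/
theorem integral_cos_mul_cos_eq_pi_mul_besselJ_zero (y : ℝ) :
    ∫ θ in (0 : ℝ)..π, cos (y * cos θ) = π * besselJ 0 y := by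
  have h1 := hasSum_integral_cos_mul_cos y (w := fun _ => 1) continuous_const (by simp)
  simp only [mul_one] at h1
  have h2 : HasSum (fun k => π * besselJTerm 0 y k) (π * besselJ 0 y) :=
    (hasSum_besselJ_holds 0 y).mul_left π
  refine h1.unique ?_
  have h3 : (fun k : ℕ => (-1) ^ k * y ^ (2 * k) / (2 * k)! * ∫ θ in (0 : ℝ)..π, cos θ ^ (2 * k)) =
      fun k => π * besselJTerm 0 y k := by
    funext k
    rw [integral_cos_pow_even_eq, pi_mul_besselJTerm_zero]
  rw [h3]
  exact h2

/-- `J₀(y) = π⁻¹ ∫₀^π cos(y cos θ) dθ` (Andrews–Askey–Roy (4.9.12) with `n = 0`; DLMF 10.9.1). [cite: AndrewsAskeyRoy1999, §4.9 (4.9.12)] -/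
theorem besselJ_zero_eq_integral_cos_mul_cos (y : ℝ) :
    besselJ 0 y = π⁻¹ * ∫ θ in (0 : ℝ)..π, cos (y * cos θ) := by
  rw [integral_cos_mul_cos_eq_pi_mul_besselJ_zero, ← mul_assoc, inv_mul_cancel₀ pi_ne_zero, one_mul]

/-- **Poisson's integral for `J₁`**: `y ∫₀^π cos(y cos θ) sin²θ dθ = π J₁(y)` for every real `y`
(Andrews–Askey–Roy (4.9.12) with `n = 1`, `(1/2)₁ = 1/2`; DLMF 10.9.4 with `ν = 1`; Lieb–Wu,
Physica A 321 (2003) §6 quote the equivalent `J₁(ω) = ω π⁻¹ ∫₀^π cos(ω sin p) cos²p dp`). Proof: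
term-wise integration and `∫₀^π cos^{2k} sin² = π(2k)!/(4^k k!² (2k+2))`. [cite: AndrewsAskeyRoy1999, §4.9 (4.9.12)] -/
theorem mul_integral_cos_mul_cos_mul_sin_sq_eq_pi_mul_besselJ_one (y : ℝ) :
    y * ∫ θ in (0 : ℝ)..π, cos (y * cos θ) * sin θ ^ 2 = π * besselJ 1 y := by
  have h1 := (hasSum_integral_cos_mul_cos y (w := fun θ => sin θ ^ 2) (by fun_prop)
    (fun θ => by
      rw [abs_of_nonneg (sq_nonneg _), sq_le_one_iff_abs_le_one]; exact abs_sin_le_one θ)).mul_left y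
  have h2 : HasSum (fun k => π * besselJTerm 1 y k) (π * besselJ 1 y) :=
    (hasSum_besselJ_holds 1 y).mul_left π
  refine h1.unique ?_
  have h3 : (fun k : ℕ => y * ((-1) ^ k * y ^ (2 * k) / (2 * k)! *
      ∫ θ in (0 : ℝ)..π, cos θ ^ (2 * k) * sin θ ^ 2)) = fun k => π * besselJTerm 1 y k := by
    funext k
    rw [integral_cos_pow_even_mul_sin_sq_eq, pi_mul_besselJTerm_one]
  rw [h3]
  exact h2

/-- `J₁(y) / y = π⁻¹ ∫₀^π cos(y cos θ) sin²θ dθ` for `y ≠ 0` (Andrews–Askey–Roy (4.9.12) with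
`n = 1`; DLMF 10.9.4 with `ν = 1`). [cite: AndrewsAskeyRoy1999, §4.9 (4.9.12)] -/
theorem besselJ_one_div_eq_integral (y : ℝ) (hy : y ≠ 0) :
    besselJ 1 y / y = π⁻¹ * ∫ θ in (0 : ℝ)..π, cos (y * cos θ) * sin θ ^ 2 := by
  have h := mul_integral_cos_mul_cos_mul_sin_sq_eq_pi_mul_besselJ_one y
  field_simp
  linarith

end Literature.Analysis.FunctionSpaces
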